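import Mathlib.Algebra.BigOperators.Fin
import Literature.Computability.Complexity.LabelCover
import Literature.Computability.Complexity.GapSetCover
import HarnessLib

/-!
# The Lund–Yannakakis reduction from label cover to gap exact set cover, I: construction and completeness

Topic `Computability/Complexity`, namespace `Literature.Computability.Complexity` (dot-lemmas
under `LabelCoverConstraint` / `LabelCoverInstance`). Second brick, after `LabelCover.lean`,
under Arora–Babai–Stern–Sweedyk 1997, Prop. 6 (`AroraEtAl1997_prop6`, `GapSetCover.lean`):
the transformation of Arora–Barak 2009, Thm. 22.31 ([LY94]) from regular projection `2CSP_W`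
instances to SET-COVER, at the level of instances, with the hypercube set gadget. File II
(`LundYannakakisGadget.lean`) proves the gadget and counting lemmas, file III
(`LundYannakakisSoundness.lean`) the soundness bound and Thm. 22.31 from the implementation
fact below.

## The construction (Arora–Barak 2009, proof of Thm. 22.31)

Given `φ` with `n` variables over `[W]` and constraints `φ_r = (i_r, j_r, h_r)`, `r < m`, take
the `(k, W)`-set gadget (Def. 22.32) `B = {0,1}^W ≅ [2^W]`, `C_u = {b | b_u = 1}`: every cover
of `B` by sets `C_v` and complements `B ∖ C_w` uses a complementary pair `v = w` — for the
hypercube this holds with no bound `k` on the number of sets, and `|B| = 2^W` is a constant for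
the constant alphabets `W` of Thm. 22.15. The ground set is `[m] × B` (element `2^W · r + b`);
for each variable `i < n` and value `u < W` the set `S_{i,u}` (index `W · i + u`) is the union
of `{r} × C_u` over the constraints with `j_r = i` and of `{r} × (B ∖ C_{h_r(u)})` over those
with `i_r = i` ("the use of complementary sets like this is at the root of how the gadget
allows 2CSP (with projection property) to be encoded as SET-COVER"); `K = n`.

## Contents

* `LabelCoverConstraint.lyRow`, `LabelCoverInstance.lyMem`, `lySet`, `lyReduce` — the
  instance `lyReduce φ : SetCoverInstance`, with `mem_subsetAt_lyReduce`, `lyMem_block`;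
* `LabelCoverInstance.lyMap W` — the map patched off the promise (alphabet `≠ [W]` or `n > 2m`
  ↦ a fixed instance) so that it is polynomial on all inputs (regular instances have `n ≤ 2m`,
  `numVars_le_two_mul_numConstraints`, file II; `lyMap_eq_lyReduce`, file III);
* COMPLETENESS, proved: `lyReduce_mem_yesSet` — a satisfying assignment `π` yields the EXACT
  cover `{S_{i,π(i)}}_{i<n}` of size `n = K ≥ 1` (in the block of `φ_r` the sets
  `S_{j_r,π(j_r)} ⊇ {r} × C_{π(j_r)}` and `S_{i_r,π(i_r)} ⊇ {r} × (B ∖ C_{π(j_r)})` partition it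
  and no other chosen set meets it);
* the named facts `lyMap_mem_FP` (implementation: `lyMap W` is computed by an `FP` function on
  codes) and `AroraBarak2009_thm2231` (Thm. 22.31 as the Karp reduction
  `gapLabelCover W ε ≤ₚ gapSetCover c` for `16 c² ε ≤ 1`), the latter DERIVED from the former
  in file III (`AroraBarak2009_thm2231_of_FP`).

## Faithfulness / design notes

* Arora–Barak state "a set cover of size `n`" in the YES case; that cover is exact, which is
  the form of Bellare–Goldwasser–Lund–Russell 1993 quoted as Arora–Babai–Stern–Sweedyk 1997,
  Prop. 6, and what `GapSetCover.yesSet` asks (together with `K = n ≥ 1`, from `m ≥ 1`).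
* The printed NO bound is "at least `nT` sets, `T = 1/(4√ε)`", i.e. factor `c` with
  `16 c² ε ≤ 1`; `AroraBarak2009_thm2231` keeps this constant (file III proves `> n/√ε`).
* `lyMap_mem_FP` is an implementation statement about THIS map, as `dinurSafraMap_mem_FP`
  (`CSPToCMMSAReduction.lean`): for each of the `n · W ≤ 2mW` pairs `(i, u)` list the elements
  `2^W r + b` (`r < m`, `b < 2^W` constant) passing the bit test `lyRow φ_r i u b`; inputs are
  guarded to `n ≤ 2m` and alphabet `W` so the output is polynomial on every string. Not yet
  implemented on the tree's TM2 stack machines.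
* Mathlib has no set cover / label cover material; `SetCoverInstance`, `gapSetCover` are the
  tree's (`GapSetCover.lean`), `LabelCoverInstance`, `gapLabelCover` from `LabelCover.lean`.

## References

* S. Arora, B. Barak, *Computational Complexity: A Modern Approach*, CUP 2009, §22.8:
  Thm. 22.31, Def. 22.32, Lemma 22.33 and the proof (pp. 486–487).
* C. Lund, M. Yannakakis, *On the hardness of approximating minimization problems*, J. ACM 41
  (1994) 960–981, §3 (set cover via partition systems).
* M. Bellare, S. Goldwasser, C. Lund, A. Russell, *Efficient probabilistically checkable
  proofs and applications to approximations*, Proc. 25th STOC (1993) 294–304, §4.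
* S. Arora, L. Babai, J. Stern, Z. Sweedyk, J. Comput. Syst. Sci. 54 (1997), Prop. 6.
-/

namespace Literature.Computability.Complexity

open _root_.Computability Finset

/-! ### The construction -/

namespace LabelCoverConstraint

/-- Row membership of the Lund–Yannakakis set `S_{i,u}` inside the block `{r} × B` of the
constraint `φ_r = (i_r, j_r, h_r)`, for the hypercube set gadget `B = [2^W]` (bit vectors),
`C_u = {b | bit u of b is set}`: the point `b` lies in `S_{i,u} ∩ ({r} × B)` iff `j_r = i` and
`b ∈ C_u`, or `i_r = i` and `b ∉ C_{h_r(u)}` ("`S_{i,u}` is the union of `{r} × C_u` for each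
`r ∈ Δ_i` and `{r} × B ∖ C_{h(u)}` for each `r ∈ Γ_i`").
[cite: AroraBarak2009, proof of Thm. 22.31 (§22.8)] -/
def lyRow (C : LabelCoverConstraint) (i u b : ℕ) : Bool :=
  (C.snd == i && b.testBit u) || (C.fst == i && !b.testBit (C.projAt u))

/-- Unfolding of `lyRow`. [cite: AroraBarak2009, proof of Thm. 22.31 (§22.8)] -/
theorem lyRow_eq_true_iff (C : LabelCoverConstraint) (i u b : ℕ) :
    C.lyRow i u b = true ↔
      (C.snd = i ∧ b.testBit u = true) ∨ (C.fst = i ∧ b.testBit (C.projAt u) = false) := by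
  simp [lyRow]

end LabelCoverConstraint

namespace LabelCoverInstance

/-- Membership of the ground-set element `e = 2^W · r + b` (row `r < m`, gadget point `b < 2^W`)
in the Lund–Yannakakis set `S_{i,u}`. [cite: AroraBarak2009, proof of Thm. 22.31 (§22.8)] -/
def lyMem (φ : LabelCoverInstance) (i u e : ℕ) : Bool :=
  match φ.constraints[e / 2 ^ φ.alphabetSize]? with
  | none => false
  | some C => C.lyRow i u (e % 2 ^ φ.alphabetSize)

/-- The Lund–Yannakakis set `S_{i,u}` (variable `i`, value `u`) as the list of its elements
`e < m · 2^W`. [cite: AroraBarak2009, proof of Thm. 22.31 (§22.8)] -/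
def lySet (φ : LabelCoverInstance) (i u : ℕ) : List ℕ :=
  (List.range (φ.numConstraints * 2 ^ φ.alphabetSize)).filter fun e => φ.lyMem i u e

/-- **The Lund–Yannakakis set cover instance of a label cover instance** (Arora–Barak 2009,
proof of Thm. 22.31, with the hypercube `(k, W)`-set gadget `B = {0,1}^W`, `C_u = {b | b_u = 1}`):
ground set `[m] × B` (element `2^W · r + b`), the `n · W` sets `S_{i,u}` (index `W · i + u`),
and `K = n`. [cite: AroraBarak2009, proof of Thm. 22.31 (§22.8)] -/
def lyReduce (φ : LabelCoverInstance) : SetCoverInstance where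
  univSize := φ.numConstraints * 2 ^ φ.alphabetSize
  sets := (List.range (φ.numVars * φ.alphabetSize)).map fun p =>
    φ.lySet (p / φ.alphabetSize) (p % φ.alphabetSize)
  K := φ.numVars

/-- The size parameter of `lyReduce φ` is `K = n`. [cite: AroraBarak2009, proof of Thm. 22.31 (§22.8)] -/
@[simp] theorem lyReduce_K (φ : LabelCoverInstance) : φ.lyReduce.K = φ.numVars := rfl

/-- The ground set of `lyReduce φ` has `m · 2^W` elements. [cite: AroraBarak2009, proof of Thm. 22.31 (§22.8)] -/
@[simp] theorem lyReduce_univSize (φ : LabelCoverInstance) :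
    φ.lyReduce.univSize = φ.numConstraints * 2 ^ φ.alphabetSize := rfl

/-- `lyReduce φ` has `n · W` sets. [cite: AroraBarak2009, proof of Thm. 22.31 (§22.8)] -/
@[simp] theorem length_lyReduce_sets (φ : LabelCoverInstance) :
    φ.lyReduce.sets.length = φ.numVars * φ.alphabetSize := by
  simp [lyReduce]

/-- Membership in the `p`-th set of `lyReduce φ`, `p < n · W`: the set is `S_{p / W, p % W}`.
[cite: AroraBarak2009, proof of Thm. 22.31 (§22.8)] -/
theorem mem_subsetAt_lyReduce (φ : LabelCoverInstance) {p e : ℕ}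
    (hp : p < φ.numVars * φ.alphabetSize) :
    e ∈ φ.lyReduce.subsetAt p ↔ e < φ.numConstraints * 2 ^ φ.alphabetSize ∧
      φ.lyMem (p / φ.alphabetSize) (p % φ.alphabetSize) e = true := by
  simp only [SetCoverInstance.subsetAt, lyReduce, List.getD_eq_getElem?_getD, List.getElem?_map,
    List.getElem?_range hp, Option.map_some, Option.getD_some, lySet, List.mem_filter,
    List.mem_range]

/-- `lyMem` on the block of row `r`: the element `2^W · r + b` belongs to `S_{i,u}` iff
`lyRow φ_r i u b`. [cite: AroraBarak2009, proof of Thm. 22.31 (§22.8)] -/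
theorem lyMem_block (φ : LabelCoverInstance) {r b : ℕ} (hr : r < φ.numConstraints)
    (hb : b < 2 ^ φ.alphabetSize) (i u : ℕ) :
    φ.lyMem i u (2 ^ φ.alphabetSize * r + b) = (φ.constraints[r]'hr).lyRow i u b := by
  have hB : 0 < 2 ^ φ.alphabetSize := Nat.pos_of_ne_zero (by positivity)
  unfold lyMem
  rw [Nat.mul_add_div hB, Nat.div_eq_of_lt hb, add_zero, Nat.mul_add_mod, Nat.mod_eq_of_lt hb,
    List.getElem?_eq_getElem (show r < φ.constraints.length from hr)]
  rfl

/-- Index bound: `W · i + u < n · W` for `i < n`, `u < W`. [folklore] -/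
theorem index_lt {W n i u : ℕ} (hi : i < n) (hu : u < W) : W * i + u < n * W := by
  calc W * i + u < W * i + W := by omega
    _ = W * (i + 1) := by ring
    _ ≤ W * n := Nat.mul_le_mul_left _ hi
    _ = n * W := Nat.mul_comm _ _

/-! ### The instance map -/

/-- **The (patched) Lund–Yannakakis instance map at alphabet size `W`.** On instances over the
alphabet `[W]` with `n ≤ 2m` (true on the promise of `gapLabelCover W ε`: regular instances
have `n ≤ 2m`, `numVars_le_two_mul_numConstraints`) it is `lyReduce`; all other instances are
sent to the fixed instance `⟨0, [], 0⟩`. The guard keeps the output polynomial in the input on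
ALL strings (the gadget has the constant size `2^W`; `n` is written in binary), the standard
patch making a Karp reduction total. [cite: AroraBarak2009, proof of Thm. 22.31 (§22.8)] -/
def lyMap (W : ℕ) (φ : LabelCoverInstance) : SetCoverInstance :=
  if φ.alphabetSize = W ∧ φ.numVars ≤ 2 * φ.numConstraints then φ.lyReduce else ⟨0, [], 0⟩

/-! ### Completeness: a satisfying assignment gives an exact cover of size `n` -/

/-- **Yes case (Arora–Barak 2009, proof of Thm. 22.31, "If the `2CSP_W` instance is
satisfiable then we exhibit a set cover of size `n`"; exactness as in Bellare–Goldwasser–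
Lund–Russell / Arora–Babai–Stern–Sweedyk 1997, Prop. 6).** For a well-formed satisfiable
label cover instance, the sets `S_{i, π(i)}`, `i < n`, of a satisfying assignment `π` form an
EXACT cover of `lyReduce φ` of size `n = K ≥ 1`: in row `r` the two sets `S_{j_r, π(j_r)} ⊇
{r} × C_{π(j_r)}` and `S_{i_r, π(i_r)} ⊇ {r} × (B ∖ C_{h_r(π(i_r))}) = {r} × (B ∖ C_{π(j_r)})`
partition the block, and no other chosen set meets it. Hence `lyReduce φ ∈ GapSetCover.yesSet`.
[cite: AroraBarak2009, proof of Thm. 22.31 (§22.8)] -/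
theorem lyReduce_mem_yesSet {φ : LabelCoverInstance} (hwf : φ.WellFormed)
    (hsat : φ.IsSatisfiable) : φ.lyReduce ∈ GapSetCover.yesSet := by
  classical
  obtain ⟨a, ha⟩ := hsat
  obtain ⟨hmpos, hC⟩ := hwf
  set n := φ.numVars with hn
  set W := φ.alphabetSize with hW
  set m := φ.numConstraints with hm
  -- the alphabet is nonempty (the first constraint is satisfied)
  have hWpos : 0 < W := by
    obtain ⟨C, hCmem⟩ := List.exists_mem_of_length_pos hmpos
    have h1 := (LabelCoverConstraint.projAt_eq_of_sat (ha C hCmem)).1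
    rw [(hC C hCmem).2.2.2.1] at h1
    exact lt_of_le_of_lt (Nat.zero_le _) h1
  -- the satisfying assignment, truncated into `[W]`
  set π : ℕ → ℕ := fun i => if a i < W then a i else 0 with hπ
  have hπlt : ∀ i, π i < W := fun i => by
    simp only [hπ]
    split_ifs with h
    · exact h
    · exact hWpos
  have hπC : ∀ C ∈ φ.constraints, π C.fst < C.proj.length ∧ C.projAt (π C.fst) = π C.snd := by
    intro C hCmem
    obtain ⟨hlt, heq⟩ := LabelCoverConstraint.projAt_eq_of_sat (ha C hCmem)
    have hwC := hC C hCmem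
    have hlen : C.proj.length = W := hwC.2.2.2.1
    have h1 : π C.fst = a C.fst := by simp only [hπ]; rw [if_pos (hlen ▸ hlt)]
    have h2 : a C.snd < W := by rw [← heq]; exact hwC.projAt_lt (hlen ▸ hlt)
    have h3 : π C.snd = a C.snd := by simp only [hπ]; rw [if_pos h2]
    rw [h1, h3]
    exact ⟨hlt, heq⟩
  -- the cover: the indices `W * i + π i` of the sets `S_{i, π i}`
  set g : ℕ → ℕ := fun i => W * i + π i with hg
  have hgdm : ∀ i, g i / W = i ∧ g i % W = π i := fun i => by
    have hu := hπlt i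
    change (W * i + π i) / W = i ∧ (W * i + π i) % W = π i
    exact ⟨by rw [Nat.mul_add_div hWpos, Nat.div_eq_of_lt hu, add_zero],
      by rw [Nat.mul_add_mod, Nat.mod_eq_of_lt hu]⟩
  have hginj : Function.Injective g := fun i j hij => by
    rw [← (hgdm i).1, ← (hgdm j).1]
    exact congrArg (· / W) hij
  refine ⟨WellFormed.numVars_pos ⟨hmpos, hC⟩, (Finset.range n).image g, ⟨?_, ?_⟩, ?_⟩
  · -- indices are in range
    intro p hp
    obtain ⟨i, hi, rfl⟩ := Finset.mem_image.1 hp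
    rw [length_lyReduce_sets]
    exact index_lt (Finset.mem_range.1 hi) (hπlt i)
  · -- exactness: every element lies in exactly one chosen set
    intro e he
    rw [lyReduce_univSize] at he
    have hB : 0 < 2 ^ W := Nat.pos_of_ne_zero (by positivity)
    set r := e / 2 ^ W with hr
    set b := e % 2 ^ W with hb
    have hrm : r < m := (Nat.div_lt_iff_lt_mul hB).2 he
    have hbB : b < 2 ^ W := Nat.mod_lt _ hB
    have he' : e = 2 ^ W * r + b := (Nat.div_add_mod e (2 ^ W)).symm
    set C := φ.constraints[r]'hrm with hCdef
    have hCmem : C ∈ φ.constraints := List.getElem_mem hrm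
    have hwC := hC C hCmem
    obtain ⟨hπlen, hπproj⟩ := hπC C hCmem
    -- the unique chosen set containing `e`
    set i₀ := if b.testBit (π C.snd) then C.snd else C.fst with hi₀
    have hi₀n : i₀ < n := by
      simp only [hi₀]
      split_ifs
      · exact hwC.2.1
      · exact hwC.1
    have key : ∀ i, e ∈ φ.lyReduce.subsetAt (g i) ↔ i = i₀ := by
      intro i
      by_cases hin : i < n
      · rw [φ.mem_subsetAt_lyReduce (index_lt hin (hπlt i)), (hgdm i).1, (hgdm i).2]
        have hblock : φ.lyMem i (π i) e = C.lyRow i (π i) b := by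
          rw [he']
          exact φ.lyMem_block hrm hbB i (π i)
        rw [hblock, LabelCoverConstraint.lyRow_eq_true_iff]
        simp only [he, true_and]
        have hne : C.fst ≠ C.snd := hwC.2.2.1
        constructor
        · rintro (⟨hsi, htb⟩ | ⟨hfi, htb⟩)
          · subst hsi
            simp [hi₀, htb]
          · subst hfi
            rw [hπproj] at htb
            simp [hi₀, htb]
        · intro hi
          subst hi
          cases htb : b.testBit (π C.snd)
          · right
            have hi₀' : i₀ = C.fst := by simp [hi₀, htb]
            rw [hi₀', hπproj]
            exact ⟨rfl, htb⟩
          · left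
            have hi₀' : i₀ = C.snd := by simp [hi₀, htb]
            rw [hi₀']
            exact ⟨rfl, htb⟩
      · constructor
        · intro hmem
          exfalso
          -- an index `g i` with `i ≥ n` is out of range, so its set is empty
          have : φ.lyReduce.subsetAt (g i) = [] := by
            simp only [SetCoverInstance.subsetAt, List.getD_eq_getElem?_getD]
            rw [List.getElem?_eq_none]
            · rfl
            · rw [length_lyReduce_sets]
              calc n * W ≤ i * W := Nat.mul_le_mul_right _ (not_lt.1 hin)
                _ = W * i := Nat.mul_comm _ _
                _ ≤ g i := Nat.le_add_right _ _
          rw [this] at hmem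
          simp at hmem
        · rintro rfl
          exact absurd hi₀n hin
    rw [Finset.card_eq_one]
    refine ⟨g i₀, Finset.ext fun p => ?_⟩
    simp only [Finset.mem_filter, Finset.mem_image, Finset.mem_range, Finset.mem_singleton]
    constructor
    · rintro ⟨⟨i, -, rfl⟩, hmem⟩
      rw [(key i).1 hmem]
    · rintro rfl
      exact ⟨⟨i₀, hi₀n, rfl⟩, (key i₀).2 rfl⟩
  · rw [Finset.card_image_of_injective _ hginj, Finset.card_range, lyReduce_K]

end LabelCoverInstance

/-! ### The named facts -/

/-- **Implementation fact: the Lund–Yannakakis map is polynomial time** ("there is a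
polynomial-time transformation `f` from `2CSP_W` instances to instances of SET-COVER"). For
every `W` some `f ∈ FP` satisfies `f (code φ) = code (lyMap W φ)` for every label cover
instance `φ` (codes: `LabelCoverInstance.encoding`, `SetCoverInstance.encoding`; off the
codewords `f` is unconstrained). The map writes, for each of the `n · W ≤ 2m · W` pairs
`(i, u)`, the list of the elements `2^W · r + b` (`r < m`, `b < 2^W`, `W` a constant) passing
the bit test `lyRow φ_r i u b` — a routine nested loop; vendored as a named fact pending its
TM2 implementation (cf. `dinurSafraMap_mem_FP`, `CSPToCMMSAReduction.lean`).
[cite: AroraBarak2009, Thm. 22.31 (§22.8, p. 486: "polynomial-time transformation")] -/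
def lyMap_mem_FP : Prop :=
  ∀ W : ℕ, ∃ f ∈ FP, ∀ φ : LabelCoverInstance,
    f (LabelCoverInstance.encoding.encode φ) =
      SetCoverInstance.encoding.encode (LabelCoverInstance.lyMap W φ)

/-- **Arora–Barak 2009, Thm. 22.31 (Lund–Yannakakis 1994; exactness of the cover as in
Bellare–Goldwasser–Lund–Russell 1993 / Arora–Babai–Stern–Sweedyk 1997, Prop. 6), as a Karp
reduction of promise problems.** Printed: "for every `ε, W > 0` there is a polynomial-time
transformation `f` from `2CSP_W` instances to instances of SET-COVER such that if the `2CSP_W`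
instance is regular and satisfies the projection property then" `val(φ) = 1 ⇒` there is a set
cover of size `N` (proof: the `n` sets `S_{i,π(i)}` — an exact cover, `lyReduce_mem_yesSet`) and
`val(φ) < ε ⇒` every set cover has size at least `N / (4√ε)` (proof, Claim; here
`sq_numVars_lt_of_isCover` gives `> N/√ε`), "where `N` depends upon `φ`". Rendered: for
rational `c > 0` with `c ≤ 1/(4√ε)`, i.e. `16 c² ε ≤ 1`, `gapLabelCover W ε` Karp-reduces to
`gapSetCover c` (YES: an exact cover of size `K = N ≥ 1`; NO: every cover has `≥ c K` sets). It
follows from the implementation fact `lyMap_mem_FP` (`AroraBarak2009_thm2231_of_FP`,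
`LundYannakakisSoundness.lean`, where the instance-level content is proved). [cite: AroraBarak2009, Thm. 22.31 (§22.8, p. 486)] -/
def AroraBarak2009_thm2231 : Prop :=
  ∀ (W : ℕ) (ε : ℝ) (c : ℚ), 0 < ε → 0 < c → (c : ℝ) ^ 2 * ε * 16 ≤ 1 →
    (gapLabelCover W ε).PolyTimeReducible (gapSetCover c)

end Literature.Computability.Complexity
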